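import Mathlib.AlgebraicGeometry.EllipticCurve.VariableChange
import Literature.NumberTheory.EllipticCurves.MordellWeil
import Literature.NumberTheory.EllipticCurves.AnalyticRank
import Literature.NumberTheory.EllipticCurves.GlobalMinimalModel
import Literature.NumberTheory.EllipticCurves.Heights
import Literature.NumberTheory.EllipticCurves.Regulator
import Literature.NumberTheory.EllipticCurves.RealPeriod
import Literature.NumberTheory.EllipticCurves.Tamagawa
import Literature.NumberTheory.EllipticCurves.GaloisAction
import Literature.NumberTheory.EllipticCurves.Sha
import HarnessLib

-- provenance: harness21/H21/H21/Prelude/TranscendEllArithS/BSDInvariants.lean @ 42d0886 (interim HEAD d8f2665); M5 mechanical rewrite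
/-!
# The Birch–Swinnerton-Dyer invariants of an elliptic curve over `ℚ`

Trunk T-ELLARITH (group G06, outline `TranscendEllArithS`, item C22 `BSDInvariants`, glue file);
notions `analytic_rank`, `mordell_weil_rank`, `regulator_elliptic`, `real_period`,
`tamagawa_numbers`, `sha_group`.

For a Weierstrass equation `W` of an elliptic curve `E` over `ℚ` this file assembles the invariants
entering the conjecture of Birch and Swinnerton-Dyer, all defined in the imported prelude files,

* `r_an = W.analyticRank`, `L^{(r)}(E,1)/r! = W.leadingLCoeff` (`AnalyticRank`),
* `r = W.mordellWeilRank`, `#E(ℚ)_tors = W.torsionOrder` (`MordellWeil`),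
* `Reg(E/ℚ) = W.regulator` (`Regulator`, on the Néron–Tate pairing of `Heights`),
* `Ω(E) = W.realPeriodRat` (this file, from `RealPeriod`),
* `∏_p c_p = W.tamagawaProduct` (`Tamagawa`),
* `#Ш(E/ℚ) = W.shaOrder`, `W.ShaFinite` (`Sha`),

into the right-hand side `W.bsdRHS = #Ш · Reg · Ω · ∏ c_p / (#E(ℚ)_tors)²` and the three clauses

* `W.BSDRankFormula` (RANK): `r_an = r`;
* `W.ShaFinite` (SHAFIN): `Ш(E/ℚ)` is finite (re-used from `Sha`, not redefined);
* `W.BSDLeadingTermFormula` (LEAD): `L^{(r_an)}(E,1)/r_an! = W.bsdRHS`;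
* `W.BSDTriple = RANK ∧ SHAFIN ∧ LEAD`.

The conjecture itself (quantified over globally minimal `W`) is stated in
`H21/Statements/BSD/LeadingTerm.lean` (**not** here); this prelude file carries no inventory tag.

## Conventions (normalisation table, outline §4.4; reviewer-verified)

| quantity | H21 declaration | normalisation |
|---|---|---|
| canonical height `ĥ` | `WeierstrassCurve.Affine.Point.canonicalHeight` | Clay-normalised: `ĥ(P) = lim h(2ⁿP)/4ⁿ`, **no** factor `½` (Wiles, Clay text; not Silverman VIII.9) |
| height pairing `⟨P,Q⟩` | `WeierstrassCurve.Affine.Point.heightPairing` | `⟨P,Q⟩ = (ĥ(P+Q) − ĥ(P) − ĥ(Q))/2`, so `⟨P,P⟩ = ĥ(P)`; `Reg = det ⟨Pᵢ,Pⱼ⟩` on a basis of `E(ℚ)/tors` |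
| real period `Ω` | `WeierstrassCurve.realPeriod`, `realPeriodRat` | `Ω = 2∫_{ψ>0} dx/√ψ` (integral of the invariant differential over all of `E(ℝ)`) on a globally minimal model; includes `c_∞ =` number of real components (`Δ > 0 ↔ 2`) |
| Tamagawa numbers `c_p` | `WeierstrassCurve.localTamagawaNumber`, `tamagawaProduct` | `c_p = [E(ℚ_p) : E₀(ℚ_p)]` as an index (no Néron model) |
| leading coefficient | `WeierstrassCurve.leadingLCoeff` | `L^{(r)}(E,1)/r!` with `r = analyticRank`, via `iteratedDeriv` of the entire continuation |
| `#Ш`, `#E(ℚ)_tors` | `WeierstrassCurve.shaOrder`, `torsionOrder` | `Nat.card` (junk value `0` if infinite — hence LEAD is meaningful only jointly with SHAFIN) |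

The remaining rows of the outline's §4.4 table (twist model `Δ(W^d) = d⁶Δ`; MZV conventions
`n₁ > ⋯ > n_k`, `2 ≤ s.head`, `mzvSpace 0 = ℚ·1`, `zagierDim`) concern `QuadraticTwist.lean` and
`MultipleZeta.lean`, not BSD, and are recorded there.

## Hypothesis binders of the `section Rat` facts (pruned-instance repair)

A `Prop`-valued `def` keeps only the section variables its body USES, so a section instance
`[W.IsElliptic]` silently disappears from a fact such as `realPeriodRat_pos : Prop := 0 < W.realPeriodRat`
(census R-128, cell `bsd-cited`, 2026-08-29: 276 such pruned binders in `Literature/NumberTheory`).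
The facts of `section Rat` whose printed statement is about an *elliptic* curve therefore carry
`[W.IsElliptic]` as an explicit HEADER binder (`def realPeriodRat_pos [W.IsElliptic] : Prop := …`),
which cannot be pruned and which every discharger and consumer already supplies; their bodies are
unchanged. For a singular `W` the instance-free statements are false: `realPeriod` takes the junk
value `0` when `∫ dx/√ψ` diverges (`y² = x³`), and two "globally minimal" singular models can have
different periods (`y² = x³ − x²` vs `y² = x³ − 4x²`, `u = 1/2`, `Ω = π` vs `π/2`; every integral
model of a singular cubic is minimal in Mathlib's sense). `leadingLCoeff_im_eq_zero` and
`bsdLeadingTermFormula_iff_re` need no such binder: they are proved for every `W`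
(`BSDInvariantsLeadingCoeffProofs`). `realPeriodRat_smul` is valid for every model by design.

## Mathlib search

Mathlib (pin v4.32.0) has `WeierstrassCurve.VariableChange`, `WeierstrassCurve.baseChange`, the
instances `(C • W).IsElliptic`, `(W.map f).IsElliptic` (all used), and nothing on BSD (grep
`Swinnerton`, `realPeriod`, `regulator` in `EllipticCurve/`: nothing). Nothing here duplicates
Mathlib.

## Design choices

* Group-wide rules (outline §0): `noncomputable section`, `open scoped Classical`, no
  `[DecidableEq K]` variable, so that all invariants refer to the same `AddCommGroup E(ℚ)` instance.
* Declarations are deliberate dot-notation extensions in `namespace WeierstrassCurve`.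
* `realPeriodRat W` is the real period of the *given* model base-changed to `ℝ`; it equals `Ω(E)`
  of BSD only when `W` is globally minimal (two globally minimal models differ by `u = ±1`,
  `isGloballyMinimal_unique`, and `realPeriod_eq_of_abs_u_eq_one`). Accordingly `bsdRHS` and
  `BSDLeadingTermFormula` are the BSD quantities only for globally minimal `W`; the statement file
  quantifies over such `W`. All other invariants are isomorphism invariants
  (`analyticRank_variableChange`, …, stated here with `sorry`d proofs).
* `ShaFinite` is *not* re-declared: `WeierstrassCurve.ShaFinite` from `Sha` is used verbatim inside
  `BSDTriple`.
* `BSDRankFormula`, `BSDLeadingTermFormula` and `BSDTriple` are *predicates* with the explicit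
  argument `(W : WeierstrassCurve ℚ)`: they are the clauses of an open conjecture (their closures
  over elliptic `W` are the BSD conjecture; `∀ W, W.IsElliptic → W.BSDRankFormula` unfolds to the
  summit statement `Literature.BSDRankConjecture`), so they are never asserted and have no `_holds`
  discharge; known cases live in `LeadingTerm`, `ComplexMultiplication`, `GrossZagierRankOne`, …
  under their hypotheses.
* `leadingLCoeff` is a complex number; LEAD is stated in `ℂ` via the coercion `ℝ → ℂ` of `bsdRHS`,
  and `leadingLCoeff_im_eq_zero` records that it is real (the `L`-series has integer coefficients).

## References

* A. Wiles, *The Birch and Swinnerton-Dyer conjecture*, Clay Mathematics Institute Millennium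
  Problems (2006), §1.
* J. Tate, *The arithmetic of elliptic curves*, Invent. Math. 23 (1974), §1, Conjecture 4.
* B. H. Gross, *Local heights on curves*, in G. Cornell, J. H. Silverman (eds.), *Arithmetic
  Geometry* (1986) (the reference "Gross in Cornell–Silverman–Stevens" of the outline), and
  B. H. Gross, *Lectures on the conjecture of Birch and Swinnerton-Dyer* (2011), §4 (conventions
  for `Reg`, `Ω`, `c_p`).
* J. H. Silverman, *The Arithmetic of Elliptic Curves*, GTM 106, Conjecture C.16.5, VII.1, VIII.8.
-/

noncomputable section

open scoped Classical

universe u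

namespace WeierstrassCurve

section Defs

variable (W : WeierstrassCurve ℚ)

/-! ### The invariants -/

/-- The real period `Ω(W) = ∫_{E(ℝ)} |ω|` of a Weierstrass equation over `ℚ`, i.e. the real period
(`WeierstrassCurve.realPeriod`) of its base change to `ℝ`. This is the BSD period `Ω(E)`
(including the number of real components) **when `W` is globally minimal**; in general it differs
from it by `|u|` for the change of variables to a minimal model (`realPeriod_smul`).
Wiles, Clay BSD text (2006), §1; Silverman, *AEC*, C.16. [folklore] -/
def realPeriodRat : ℝ :=
  (W.baseChange ℝ).realPeriod

/-- The right-hand side of the Birch–Swinnerton-Dyer leading-term formula,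
`#Ш(E/ℚ) · Reg(E/ℚ) · Ω(E) · ∏_p c_p / (#E(ℚ)_tors)²`, for a Weierstrass equation `W` over `ℚ`
(the BSD quantity when `W` is globally minimal). Junk values: `#Ш = 0` if `Ш` is infinite, so the
formula is meaningful only together with `W.ShaFinite`.
Wiles, Clay BSD text (2006), §1, formula (4); Tate (1974), Conjecture 4; Silverman, *AEC*, C.16.5. [cite: Tate1974] -/
def bsdRHS : ℝ :=
  (W.shaOrder : ℝ) * W.regulator * W.realPeriodRat * (W.tamagawaProduct : ℝ) /
    (W.torsionOrder : ℝ) ^ 2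

/-- The BSD **rank formula** (RANK) for `W`: the analytic rank `ord_{s=1} L(E,s)` equals the
Mordell–Weil rank `rank_ℤ E(ℚ)`.

This is a *predicate* on Weierstrass equations over `ℚ` (explicit argument `W`): one clause of the
**conjecture** of Birch and Swinnerton-Dyer, not a closed statement with a proof in print, so there
is no `BSDRankFormula_holds`. Its universal closure over elliptic `W`,
`∀ W : WeierstrassCurve ℚ, W.IsElliptic → W.BSDRankFormula`, unfolds to the open BSD rank
conjecture `Literature.BSDRankConjecture` (the summit statement `BirchSwinnertonDyer`); as printed:
"If `n` is the rank of the finitely generated abelian group `E(k)`, then `ord_{s=1} L(E/k, s) = n`"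
(Gross, PCMS 18 (2011), Conjecture 2.10(1), p. 16, whose ref. [2] for "the original conjecture and
the numerical evidence that led to it" is Birch–Swinnerton-Dyer, J. reine angew. Math. 218 (1965)).
For singular `W` both sides are junk values (`analyticRank`, `mordellWeilRank`). The proved cases
are vendored separately and conclude `W.BSDRankFormula` resp. `W.mordellWeilRank = W.analyticRank`
under their hypotheses: analytic rank `≤ 1` (Gross–Zagier–Kolyvagin,
`Literature.NumberTheory.EllipticCurves.rank_eq_analyticRank_of_analyticRank_le_one`; Gross,
loc. cit., p. 19) and CM with `L(E,1) ≠ 0` (Coates–Wiles,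
`Literature.NumberTheory.EllipticCurves.bsdRankFormula_of_hasCM_of_L_one_ne_zero`).
Birch–Swinnerton-Dyer (1965); Tate (1974), Conjecture 4(a); Wiles, Clay BSD text (2006);
Gross (2011), Conj. 2.10(1).
[cite: BirchSwinnertonDyer1965] [cite: GrossPCMS2011, Conj. 2.10(1), p. 16] -/
def BSDRankFormula (W : WeierstrassCurve ℚ) : Prop :=
  W.analyticRank = W.mordellWeilRank

/-- The BSD **leading-term formula** (LEAD) for `W`:
`L^{(r)}(E,1)/r! = #Ш · Reg · Ω · ∏ c_p / (#E(ℚ)_tors)²` with `r = r_an`, as an identity in `ℂ`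
(the left-hand side is real, `leadingLCoeff_im_eq_zero`). Intended for globally minimal `W` and
jointly with `W.ShaFinite`.

Like `BSDRankFormula` this is a *predicate* (explicit argument `W`) expressing a clause of the
**conjecture** of Birch and Swinnerton-Dyer (Gross, PCMS 18 (2011), Conjecture 2.10(2), p. 16:
"`c(E/k) = P(E/k) · R(E/k) · #Ш(k,E)`", with `P` the period including Tamagawa factors), not a
closed statement with a proof in print; there is no `BSDLeadingTermFormula_holds`. Proved cases
(analytic rank `≤ 1` up to the stated ambiguities, CM with `L(E,1) ≠ 0`) are vendored separately
under their hypotheses (`Literature.NumberTheory.EllipticCurves.LeadingTerm`,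
`Literature.NumberTheory.EllipticCurves.ComplexMultiplication`).
Tate (1974), Conjecture 4(b); Wiles, Clay BSD text (2006), §1; Gross in Cornell–Silverman–Stevens;
Gross (2011), Conj. 2.10(2). [cite: Tate1974] [cite: GrossPCMS2011, Conj. 2.10(2), p. 16] -/
def BSDLeadingTermFormula (W : WeierstrassCurve ℚ) : Prop :=
  W.leadingLCoeff = (W.bsdRHS : ℂ)

/-- The full BSD statement for a single Weierstrass equation `W` over `ℚ`:
RANK `∧` SHAFIN `∧` LEAD, i.e. `W.BSDRankFormula ∧ W.ShaFinite ∧ W.BSDLeadingTermFormula`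
(intended for globally minimal `W`).

A *predicate* (explicit argument `W`) packaging the **conjecture** of Birch and Swinnerton-Dyer
together with Tate's conjecture that `Ш` is finite (Gross, PCMS 18 (2011), Conjecture 2.10 and the
note after it, p. 16); not a closed statement with a proof in print, so there is no
`BSDTriple_holds`. Proved cases are vendored separately under their hypotheses (e.g.
`Literature.NumberTheory.EllipticCurves.bsdTriple_of_hasCM_of_L_one_ne_zero`, Burungale–Flach 2024).
Tate (1974), Conjecture 4; Wiles, Clay BSD text (2006), §1; Gross (2011), Conj. 2.10.
[cite: Tate1974] [cite: GrossPCMS2011, Conj. 2.10, p. 16] -/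
def BSDTriple (W : WeierstrassCurve ℚ) : Prop :=
  W.BSDRankFormula ∧ W.ShaFinite ∧ W.BSDLeadingTermFormula

/-! ### Unfolding lemmas -/

/-- Unfolding of `realPeriodRat` (by definition). Wiles, Clay BSD text (2006), §1. [folklore] -/
theorem realPeriodRat_def : W.realPeriodRat = (W.baseChange ℝ).realPeriod := rfl

/-- Unfolding of `bsdRHS` (by definition). Wiles, Clay BSD text (2006), §1. [folklore] -/
theorem bsdRHS_def :
    W.bsdRHS = (W.shaOrder : ℝ) * W.regulator * W.realPeriodRat * (W.tamagawaProduct : ℝ) /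
      (W.torsionOrder : ℝ) ^ 2 := rfl

/-- Unfolding of `BSDTriple` (by definition). Tate (1974), Conjecture 4. [cite: Tate1974] -/
theorem bsdTriple_iff :
    W.BSDTriple ↔ W.analyticRank = W.mordellWeilRank ∧ W.ShaFinite ∧
      W.leadingLCoeff = (W.bsdRHS : ℂ) := Iff.rfl

end Defs

/-! ### Isomorphism invariance of the arithmetic invariants

An admissible change of variables `C : VariableChange K` is an isomorphism of Weierstrass models
`W ≅ C • W` over `K` (Silverman, *AEC*, III.3.1(b)); every BSD invariant except the real period of
the model is unchanged. Stated as named facts (D-0014); all but `regulator_variableChange` are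
discharged in the sibling files `BSDInvariantsProofs` (transport along the induced isomorphism of
point groups and of `H¹`, equality of the formal L-function) and `BSDInvariantsTamagawaProofs`
(equality of local data of minimal models). The invariants built from point groups
only (`mordellWeilRank`, `torsionOrder`, `shaOrder`, `ShaFinite`) are invariant for every `W`; those
computed on local minimal models (`analyticRank`, `leadingLCoeff`, `tamagawaProduct`) and the
regulator require `[W.IsElliptic]`, since only for `Δ ≠ 0` is the local minimal model unique up to
an integral unimodular change of variables (Silverman, *AEC*, VII.1.3(b)). Names follow the outline
(`…_variableChange`, cf. `localTamagawaNumber_variableChange`). -/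

section Invariance

variable {K : Type u} [Field K] (W : WeierstrassCurve K) (C : VariableChange K)

/-- The Mordell–Weil rank is invariant under admissible changes of variables: `C` induces a group
isomorphism `E'(K) ≃+ E(K)`, `(x', y') ↦ (u²x' + r, u³y' + u²sx' + t)` (`E' = C • W`).
Silverman, *AEC*, III.3.1(b) and VIII.6; discharged as `mordellWeilRank_variableChange_holds`
(`BSDInvariantsProofs`). [cite: SilvermanAEC2009, III.3.1(b) and VIII.6] -/
def mordellWeilRank_variableChange : Prop :=
  (C • W).mordellWeilRank = W.mordellWeilRank

/-- The order of the torsion subgroup is invariant under admissible changes of variables (group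
isomorphism of point groups). Silverman, *AEC*, III.3.1(b) and VII.3; discharged as
`torsionOrder_variableChange_holds` (`BSDInvariantsProofs`).
[cite: SilvermanAEC2009, III.3.1(b) and VII.3] -/
def torsionOrder_variableChange : Prop :=
  (C • W).torsionOrder = W.torsionOrder

variable [NumberField K]

/-- The analytic rank of an *elliptic* curve is invariant under admissible changes of variables:
the local Euler factors (`WeierstrassCurve.localPolynomial`) are computed on local minimal models,
and since `Δ ≠ 0` the local minimal model is unique up to an integral unimodular change of
variables (Silverman, *AEC*, VII.1.3(b)), so `W.LSeries` and `W.entireLFunction` are unchanged.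
(For singular `W` Mathlib's `minimal` is an arbitrary choice and the statement fails.)
Silverman, *AEC*, C.16 with VII.1.3; discharged as `analyticRank_variableChange_holds`
(`BSDInvariantsProofs`). [cite: SilvermanAEC2009, App. C §16 with VII.1 Prop. 1.3(b)] -/
def analyticRank_variableChange : Prop :=
  ∀ [W.IsElliptic],
    (C • W).analyticRank = W.analyticRank

/-- The leading Taylor coefficient `L^{(r)}(E,1)/r!` of an *elliptic* curve is invariant under
admissible changes of variables (the L-function is, by uniqueness of local minimal models for
`Δ ≠ 0`, Silverman, *AEC*, VII.1.3(b)). Silverman, *AEC*, C.16 with VII.1.3; discharged as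
`leadingLCoeff_variableChange_holds` (`BSDInvariantsProofs`).
[cite: SilvermanAEC2009, App. C §16 with VII.1 Prop. 1.3(b)] -/
def leadingLCoeff_variableChange : Prop :=
  ∀ [W.IsElliptic],
    (C • W).leadingLCoeff = W.leadingLCoeff

/-- The order of `Ш` is invariant under admissible changes of variables: `C` induces a
`Γ_K`-equivariant isomorphism `E(K̄) ≃ E'(K̄)` compatible with all local restrictions, hence
`Ш(E/K) ≃ Ш(E'/K)`. Silverman, *AEC*, X.§4 (definition of `Ш(E/K)`, before Remark 4.1.1); Milne,
*ADT*, I.§6; discharged as `shaOrder_variableChange_holds` (`BSDInvariantsProofs`).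
[cite: SilvermanAEC2009, X.§4 (definition of Ш, Rem. 4.1.1)] [cite: MilneADT2006, I.§6] -/
def shaOrder_variableChange : Prop :=
  (C • W).shaOrder = W.shaOrder

/-- Finiteness of `Ш` is invariant under admissible changes of variables
(`Ш(E/K) ≃ Ш(E'/K)`). Silverman, *AEC*, X.§4; discharged as `shaFinite_variableChange_iff_holds`
(`BSDInvariantsProofs`). [cite: SilvermanAEC2009, X.§4 (definition of Ш, Rem. 4.1.1)] -/
def shaFinite_variableChange_iff : Prop :=
  (C • W).ShaFinite ↔ W.ShaFinite

/-- The Tamagawa product of an *elliptic* curve is invariant under admissible changes of variables: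
each local factor `c_v` is computed on a local minimal model, which for `Δ ≠ 0` is unique up to an
integral unimodular change of variables (Silverman, *AEC*, VII.1.3(b)), and the index
`[E(K_v) : E₀(K_v)]` is unchanged by such a change. (For singular `W` Mathlib's `minimal` is an
arbitrary choice and the statement fails.)
Silverman, *AEC*, VII.6 (Thm. 6.1, Cor. 6.2), Ex. 7.6, and C.16 (`c_p = #E(ℚ_p)/E₀(ℚ_p)`); Wiles,
Clay BSD text (2006), §1; discharged as `tamagawaProduct_variableChange_holds`
(`BSDInvariantsTamagawaProofs`).
[cite: SilvermanAEC2009, VII.6 (Thm. 6.1, Cor. 6.2) with VII.1 Prop. 1.3(b); App. C §16] -/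
def tamagawaProduct_variableChange : Prop :=
  ∀ [W.IsElliptic],
    (C • W).tamagawaProduct = W.tamagawaProduct

/-- The elliptic regulator is invariant under admissible changes of variables: the canonical height
is an isomorphism invariant (`ĥ' ∘ φ = ĥ`, Silverman, *AEC*, VIII.9.3 uniqueness) and `φ` maps a
Mordell–Weil basis to a Mordell–Weil basis. Silverman, *AEC*, VIII.9 (Thm. 9.3 and the definition
of the elliptic regulator `R_{E/K} = det ⟨Pᵢ, Pⱼ⟩` after Cor. 9.7) and C.16; Gross in
Cornell–Silverman–Stevens, Ch. I. Not yet discharged.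
[cite: SilvermanAEC2009, VIII.9 (Thm. 9.3; definition of R_{E/K}) and App. C §16] -/
def regulator_variableChange : Prop :=
  ∀ [W.IsElliptic],
    (C • W).regulator = W.regulator

end Invariance

/-! ### Sanity statements over `ℚ` -/

section Rat

variable (W : WeierstrassCurve ℚ)

/-- Behaviour of `realPeriodRat` under a rational change of variables: `Ω(C • W) = |u| · Ω(W)`
(from `realPeriod_smul` and `map_variableChange`; valid for every model, elliptic or not).
Silverman, *AEC*, III.1, Table 3.1. [folklore] -/
def realPeriodRat_smul : Prop :=
  ∀ (C : VariableChange ℚ),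
    (C • W).realPeriodRat = |(C.u : ℝ)| * W.realPeriodRat

/- interim proof relied on results that are now named facts (D-0014); demoted to a fact by the M5 import, proof preserved:
:= by
  simp only [realPeriodRat_def, baseChange]
  rw [← map_variableChange, realPeriod_smul]
  simp
-/

/-- Two globally minimal models over `ℚ` have the same real period (they differ by `u = ±1`,
`isGloballyMinimal_unique`, and `realPeriod_eq_of_abs_u_eq_one`). Hence `Ω(E)` is well defined.
For an *elliptic* `W` (header binder `[W.IsElliptic]`, see the module docstring; false for singular cubics,
where every integral model is minimal). PROVED: `realPeriodRat_variableChange_of_isGloballyMinimal_holds`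
(`BSDInvariantsProofs.lean`). Silverman, *AEC*, VIII.8.3 and C.16; Wiles, Clay BSD text (2006), §1.
[cite: SilvermanAEC2009, VIII.8.3 with Prop. VII.1.3(b), and App. C §16 (Ω on a global minimal equation)] -/
def realPeriodRat_variableChange_of_isGloballyMinimal [W.IsElliptic] : Prop :=
  ∀ [W.IsGloballyMinimal] (C : VariableChange ℚ) [(C • W).IsGloballyMinimal],
    (C • W).realPeriodRat = W.realPeriodRat

/- interim proof relied on results that are now named facts (D-0014); demoted to a fact by the M5 import, proof preserved:
:= by
  rw [realPeriodRat_smul]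
  rcases (W.isGloballyMinimal_unique C).1 with h | h <;> simp [h]
-/

/-- The BSD right-hand side is the same for any two globally minimal models of `E/ℚ`.
For an *elliptic* `W` (header binder `[W.IsElliptic]`). PROVED:
`bsdRHS_variableChange_of_isGloballyMinimal_holds` (`BSDInvariantsMinimalModelProofs.lean`).
Wiles, Clay BSD text (2006), §1; Tate (1974), Conjecture 4. [cite: Tate1974] -/
def bsdRHS_variableChange_of_isGloballyMinimal [W.IsElliptic] : Prop :=
  ∀ [W.IsGloballyMinimal] (C : VariableChange ℚ) [(C • W).IsGloballyMinimal],
    (C • W).bsdRHS = W.bsdRHS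

/- interim proof relied on results that are now named facts (D-0014); demoted to a fact by the M5 import, proof preserved:
:= by
  rw [bsdRHS_def, bsdRHS_def, shaOrder_variableChange, regulator_variableChange,
    realPeriodRat_variableChange_of_isGloballyMinimal, tamagawaProduct_variableChange,
    torsionOrder_variableChange]
-/

/-- The BSD statement RANK ∧ SHAFIN ∧ LEAD does not depend on the choice of the global minimal
model of `E/ℚ` (invariance under the integral unimodular changes of variables between two globally
minimal models). For an *elliptic* `W` (header binder `[W.IsElliptic]`). PROVED:
`bsdTriple_variableChange_of_isGloballyMinimal_holds` (`BSDInvariantsMinimalModelProofs.lean`).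
Wiles, Clay BSD text (2006), §1; Tate (1974), Conjecture 4. [cite: Tate1974] -/
def bsdTriple_variableChange_of_isGloballyMinimal [W.IsElliptic] : Prop :=
  ∀ [W.IsGloballyMinimal] (C : VariableChange ℚ) [(C • W).IsGloballyMinimal],
    (C • W).BSDTriple ↔ W.BSDTriple

/- interim proof relied on results that are now named facts (D-0014); demoted to a fact by the M5 import, proof preserved:
:= by
  simp only [bsdTriple_iff, analyticRank_variableChange, mordellWeilRank_variableChange,
    shaFinite_variableChange_iff, leadingLCoeff_variableChange,
    bsdRHS_variableChange_of_isGloballyMinimal]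
-/

/-- The real period of (any model of) an elliptic curve over `ℚ` is positive. The hypothesis
`[W.IsElliptic]` is a header binder (see the module docstring): for a singular model the integral may
diverge and `realPeriod` is then the junk value `0` (`y² = x³`), so the instance-free statement is false.
PROVED: `realPeriodRat_pos_holds` (`ComplexMultiplicationBurungaleFlachProofs.lean`).
Silverman, *AEC*, C.16 ("`E/ℚ` an elliptic curve … `Ω = ∫_{E(ℝ)}|ω|`"); Cremona, *Algorithms*, §3.7.
[cite: CremonaAlgorithms1997, §3.7 (3.7.1)] [cite: SilvermanAEC2009, App. C §16 (notation before Conj. 16.5)] -/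
def realPeriodRat_pos [W.IsElliptic] : Prop :=
  0 < W.realPeriodRat

/- interim proof relied on results that are now named facts (D-0014); demoted to a fact by the M5 import, proof preserved:
:=
  haveI : (W.baseChange ℝ).IsElliptic := by rw [baseChange]; infer_instance
  (W.baseChange ℝ).realPeriod_pos
-/

/-- If `Ш(E/ℚ)` is finite, the BSD right-hand side is a positive real number (all factors are
positive: `shaOrder_pos`, `regulator_pos`, `realPeriod_pos`, `tamagawaProduct_pos`,
`torsionOrder_pos`). Without `ShaFinite` the junk value `#Ш = 0` makes it vanish.
For an *elliptic* `W` (header binder `[W.IsElliptic]`). PROVED: `bsdRHS_pos_holds`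
(`BSDInvariantsPositivityProofs.lean`). Wiles, Clay BSD text (2006), §1; Silverman, *AEC*, C.16.5.
[cite: SilvermanAEC2009, Conj. C.16.5 with Cor. VII.6.2 and Cor. VIII.9.7] -/
def bsdRHS_pos [W.IsElliptic] : Prop :=
  ∀ (h : W.ShaFinite),
    0 < W.bsdRHS

/- interim proof relied on results that are now named facts (D-0014); demoted to a fact by the M5 import, proof preserved:
:= by
  have h₁ : (0 : ℝ) < W.shaOrder := Nat.cast_pos.mpr (W.shaOrder_pos h)
  have h₂ : (0 : ℝ) < W.regulator := W.regulator_pos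
  have h₃ : (0 : ℝ) < W.realPeriodRat := W.realPeriodRat_pos
  have h₄ : (0 : ℝ) < W.tamagawaProduct := Nat.cast_pos.mpr W.tamagawaProduct_pos
  have h₅ : (0 : ℝ) < W.torsionOrder := Nat.cast_pos.mpr W.torsionOrder_pos
  rw [bsdRHS_def]
  positivity
-/

/-- The leading Taylor coefficient `L^{(r)}(E,1)/r!` of an elliptic curve over `ℚ` is real: the
Dirichlet coefficients `aₙ` are integers, so the entire continuation satisfies
`L(E, s̄) = conj (L(E,s))` and all Taylor coefficients at the real point `s = 1` are real
(reflection principle for the entire continuation; the integrality of the coefficients is the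
definition `L_{E/K}(s) = ∏_v L_v(q_v^{-s})⁻¹`, `L_v ∈ ℤ[T]`, Silverman, *AEC*, C.16; Wiles, Clay BSD
text (2006), §1). No ellipticity hypothesis: the statement is proved for every `W` over `ℚ`
(`leadingLCoeff_im_eq_zero_holds`, `BSDInvariantsLeadingCoeffProofs.lean`).
[cite: SilvermanAEC2009, App. C §16 (definition of L_{E/K}, integer Euler factors)] -/
def leadingLCoeff_im_eq_zero : Prop :=
  (W.leadingLCoeff).im = 0

/-- Consequently LEAD may be read as an identity of real numbers:
`(W.leadingLCoeff).re = W.bsdRHS` (for every `W`; PROVED: `bsdLeadingTermFormula_iff_re_holds`,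
`BSDInvariantsLeadingCoeffProofs.lean`). Wiles, Clay BSD text (2006), §1. [folklore] -/
def bsdLeadingTermFormula_iff_re : Prop :=
  W.BSDLeadingTermFormula ↔ (W.leadingLCoeff).re = W.bsdRHS

/- interim proof relied on results that are now named facts (D-0014); demoted to a fact by the M5 import, proof preserved:
:= by
  have him := W.leadingLCoeff_im_eq_zero
  unfold BSDLeadingTermFormula
  constructor
  · intro h
    rw [h, Complex.ofReal_re]
  · intro h
    exact Complex.ext (by rw [h, Complex.ofReal_re]) (by rw [him, Complex.ofReal_im])
-/

end Rat

end WeierstrassCurve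

end
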